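import Literature.Barriers.CriticalPhenomena.LaceExpansionEtaZeroXSpaceThreeInputs
import Literature.Barriers.CriticalPhenomena.LaceExpansionXSpaceWeightedNLoop
import HarnessLib

/-!
# `Hara2008_etaZeroXSpace` (Heydenreich–van der Hofstad Thm. 11.4) from the subcritical expansion,
# the two-long-lines estimate and Fitzner–van der Hofstad's numerical triangle bounds

Barrier catalogue `Literature/Barriers/CriticalPhenomena/` (D-0021), continuation of
`LaceExpansionEtaZeroXSpaceThreeInputs.lean` (`Hara2008_etaZeroXSpace_of_threeInputs`: the
subcritical expansion `Hara2008_prop12Subcrit`, the two-long-lines estimate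
`Hara2008_twoLongLinesDiagramBoundPc` and the weighted `N`-loop estimate
`Hara2008_weightedNLoopBoundPc`) and of `LaceExpansionXSpaceWeightedNLoop.lean`, where Hara's
weighted `N`-loop estimate (Hara 2008, §3.4) is PROVED on the Hara–Slade diagrams in the
`T̄^{(0,β)}`-variant — hypotheses `W̄^{(β,γ)}, T̄^{(0,γ)}, T̄^{(0,β)} < ∞` in place of the printed
`W̄^{(β,0)}, H̄^{(β)} < ∞`, see that file's module docstring — with the geometric rate
`2Δ̃_{p_c}Δ_{p_c} < 1`, which for `d ≥ 11` is Fitzner–van der Hofstad's numerical input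
`FitznerVanDerHofstad2017_triangleBoundsPc` (`LaceExpansionXSpaceTriangleNumerics.lean`:
`T_{p_c} ≤ 0.28036`, `T̄^{(0,0)} ≤ 0.53562`, EJP 2017, §7, (7.1)).

This file re-runs Hara's `x`-space reduction (§1.2.3–§1.2.4, proved in
`LaceExpansionXSpaceBootstrap.lean` from the named facts `Hara2008_lemma15Pc`, `Hara2008_lemma16Pc`,
`Hara2008_lemma17Pc`) with the `T̄^{(0,β)}`-variant of Lemma 1.6 in place of `Hara2008_lemma16Pc`.
Nothing else changes: in the recursion of §1.2.4 ("we start from `φ₀ = 2` and choose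
`β_{i+1} = 2`, `γ_{i+1} = {(d-6) ∧ ⌊φ_i⌋} - ε`") the variant is applied with `β = 2`, and its extra
hypothesis `T̄^{(0,2)} < ∞` is supplied by Lemma 1.7 (`Hara2008_lemma17Pc_holds`, clause `T̄^{(β,γ)}`
at `β = 0`, `γ = 2 ≤ ⌊φ⌋`, `2 < d - 6`) exactly as `T̄^{(0,γ)} < ∞` is.

## Main results (all proved; namespace `Literature.Barriers.CriticalPhenomena`)

* `piMoment_stepT`, `piMoment_iterateT`, `haraGBar_lt_top_of_lemma16T` — the recursion of
  §1.2.4 with the `T̄^{(0,β)}`-variant of Lemma 1.6 as hypothesis (`Σ|x|²|Π| < ∞ ⟹ Ḡ^{(d-4-ε)} < ∞`,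
  `ε = 1/4`);
* `xSpacePiBound_of_haraGBar` — steps 2–4 of the reduction (`Ḡ^{(d-4-ε)} < ∞`, Lemma 1.5, the
  Gaussian lemma Cor. 1.4, Lemma 1.5 again `⟹ |Π(x)| ≤ c⟦x⟧^{-2(d-2)}`), i.e.
  `xSpacePiBound_of_lemmas` of `LaceExpansionXSpaceBootstrap.lean` with its first step abstracted
  into the hypothesis `Ḡ^{(d-17/4)} < ∞`;
* `Hara2008_xSpacePiBoundPc_of_lemma16T`, `Hara2008_laceExpansionPc_of_lemma16T`,
  `Hara2008_etaZeroXSpace_of_lemma16T` — the assemblies of `LaceExpansionXSpaceBootstrap.lean` with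
  `Hara2008_lemma16Pc` replaced by the variant;
* `piNDecompositionPc_of_triangleBounds`, `Hara2008_lemma15Pc_of_triangleBounds` — Lemma 1.5 from
  the two-long-lines estimate, the Hara–Slade coefficients below the diagrams
  (`HvdH2017_piNDiagramBoundPc_holds`) and the summability of the diagrams
  (`tsum_tsum_piNDiagramPc_ne_top`, from the numerical triangle bounds);
* `Hara2008_laceExpansionPc_of_numerics`, `Hara2008_etaZeroXSpace_of_numerics` — **`η = 0` in
  `x`-space for `d ≥ 11` from `Hara2008_prop12Subcrit`, `Hara2008_twoLongLinesDiagramBoundPc` and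
  `FitznerVanDerHofstad2017_triangleBoundsPc`**: after this file the weighted `N`-loop estimate
  `Hara2008_weightedNLoopBoundPc` is no longer in the trust base of `Hara2008_etaZeroXSpace`, which
  consists of the subcritical lace expansion with `p`-uniform bounds (Hara 2008, Prop. 1.2 below
  `p_c`), the two-long-lines estimate (§3.5) and the computer-assisted triangle bounds of
  Fitzner–van der Hofstad 2017, §7 — the Gaussian lemma (Thm. 1.3, Cor. 1.4), the framework of §1.2
  and Appendix A, Lemma 1.7, the bound (7.4.10) on the Hara–Slade coefficients and the weighted
  `N`-loop estimate in the `T̄^{(0,β)}`-variant being theorems of the catalogue.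

## References

* T. Hara, Ann. Probab. 36 (2008) 530–593 (arXiv:math-ph/0504021): Thm. 1.1, Prop. 1.2,
  §1.2.3 (Lemma 1.5, the two passes), §1.2.4 (Lemmas 1.6–1.7, the recursion for percolation,
  "`d > 10`"), §3.4 (Steps 1–3 and Summary), §3.5, Appendix A.
* M. Heydenreich, R. van der Hofstad, *Progress in High-Dimensional Percolation and Random
  Graphs*, Springer 2017: Thm. 11.4 and pp. 137–139; (7.4.10), Prop. 7.4; Cor. 8.13.
* R. Fitzner, R. van der Hofstad, Electron. J. Probab. 22 (2017) no. 43 (arXiv:1506.07977):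
  Thm. 1.4 and §7, proof of Thm. 1.4 ((7.1): `T̄^{(0,0)} ≤ 0.53562`, `T_{p_c} ≤ 0.28036` in `d = 11`;
  "by a recent improvement of the bounds by Hara compared to [Hara08], it suffices to prove that
  `T_{p_c}(1 + 2T̄^{(0,0)}) < 1`") and proof of Thm. 1.5 (`Π̂^{(N)}_{p_c}(0) ≤ T'[2T_{p_c}T']^{N-1}`).
-/

noncomputable section

namespace Literature.Barriers.CriticalPhenomena

open _root_.MeasureTheory _root_.Filter _root_.Topology Literature.Probability.LatticeModels
  Literature.Probability.Percolation

open scoped ENNReal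

variable {d : ℕ}

/-! ### The recursion of §1.2.4 with the `T̄^{(0,β)}`-variant of Lemma 1.6

The hypothesis `h16T` below is the statement proved, from the Hara–Slade coefficients below the
diagrams and the smallness `2Δ̃_{p_c}Δ_{p_c} < 1` for `d ≥ 11`, by
`Hara2008_lemma16T_of_diagramBounds` (`LaceExpansionXSpaceWeightedNLoop.lean`): for `d ≥ 11`, the
lace-expansion coefficient `Φ` and `β, γ ≥ 0` with `W̄^{(β,γ)}, T̄^{(0,γ)}, T̄^{(0,β)} < ∞`,
`Σ_x |x|^{β+γ}|Φ(x)| < ∞`. One step of the recursion takes `Σ|x|^φ|Π| < ∞` (`⌊φ⌋ = n`,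
`2 ≤ n ≤ d - 6`) to `Σ|x|^{n+7/4}|Π| < ∞` via Lemma 1.7 for `W̄^{(2,n-1/4)}`, `T̄^{(0,n-1/4)}`,
`T̄^{(0,2)}` and the variant with `β = 2`, `γ = n - 1/4`. -/

/-- **One step of the recursion, `T̄^{(0,β)}`-variant** (the proof of `piMoment_step` with
`T̄^{(0,2)} < ∞` — Lemma 1.7, clause `T̄`, at `β = 0`, `γ = 2 ≤ ⌊φ⌋`, `2 < d - 6` — in place of
`H̄^{(2)} < ∞`). [cite: Hara2008, §1.2.4 (proof for percolation, the recursion with β_{i+1} = 2) and Lemma 1.7] -/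
theorem piMoment_stepT
    (h16T : ∀ (d : ℕ), 11 ≤ d → ∀ Φ : Site d → ℝ, IsLaceCoefficientPc d Φ →
      ∀ β γ : ℝ, 0 ≤ β → 0 ≤ γ → haraWBar d β γ < ⊤ → haraTBar d 0 γ < ⊤ → haraTBar d 0 β < ⊤ →
        Summable fun x : Site d => euclidNorm x ^ (β + γ) * |Φ x|)
    (h17 : Hara2008_lemma17Pc) (hd : 11 ≤ d)
    {Φ : Site d → ℝ} (hΦ : IsLaceCoefficientPc d Φ) {φ : ℝ} {n : ℤ}
    (hn : ⌊φ⌋ = n) (hn2 : 2 ≤ n) (hnd : n ≤ (d : ℤ) - 6)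
    (hmom : Summable fun x : Site d => euclidNorm x ^ φ * |Φ x|) :
    Summable fun x : Site d => euclidNorm x ^ ((n : ℝ) + 7 / 4) * |Φ x| := by
  have hdR : (11 : ℝ) ≤ d := by exact_mod_cast hd
  have hn2R : (2 : ℝ) ≤ n := by exact_mod_cast hn2
  -- `2 ≤ n = ⌊φ⌋ ≤ φ`: the moment hypothesis of Lemma 1.7 holds with `φ ≥ 2`
  have hnle : ((n : ℤ) : ℝ) ≤ φ := hn ▸ Int.floor_le φ
  obtain ⟨-, hW, hT, -, -⟩ := h17 d hd Φ hΦ φ (by linarith) hmom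
  have hnφ : ((⌊φ⌋ : ℤ) : ℝ) = n := by rw [hn]
  have hndR : (n : ℝ) ≤ d - 6 := by
    have : ((n : ℤ) : ℝ) ≤ ((d : ℤ) - 6 : ℤ) := by exact_mod_cast hnd
    push_cast at this
    exact this
  set γ : ℝ := (n : ℝ) - 1 / 4 with hγ
  have hγ0 : 0 ≤ γ := by rw [hγ]; linarith
  have hγodd : ¬ IsOddInt γ := not_isOddInt_int_sub (by norm_num) (by norm_num)
  have hγfloor : (⌊γ⌋ : ℝ) = n - 1 := by
    rw [hγ, floor_int_sub (by norm_num) (by norm_num)]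
    push_cast
    ring
  have h2floor : (⌊(2 : ℝ)⌋ : ℝ) = 2 := by norm_num
  have h0floor : (⌊(0 : ℝ)⌋ : ℝ) = 0 := by norm_num
  -- `W̄^{(2,γ)} < ∞`
  have hW' : haraWBar d 2 γ < ⊤ := by
    refine hW 2 γ (by norm_num) hγ0 not_isOddInt_two hγodd ?_ ?_ ?_ ?_
    · rw [hnφ]; exact hn2R
    · rw [hnφ, hγ]; linarith
    · rw [hγ]; linarith
    · rw [h2floor, hγfloor, hγ]; linarith
  -- `T̄^{(0,γ)} < ∞`
  have hT' : haraTBar d 0 γ < ⊤ := by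
    refine hT 0 γ le_rfl hγ0 not_isOddInt_zero hγodd ?_ ?_ ?_ ?_
    · rw [hnφ]; linarith
    · rw [hnφ, hγ]; linarith
    · rw [hγ]; linarith
    · rw [h0floor, hγfloor, hγ]; linarith
  -- `T̄^{(0,2)} < ∞` (the extra hypothesis of the variant; Lemma 1.7 at `β = 0`, `γ = 2`)
  have hT2 : haraTBar d 0 2 < ⊤ := by
    refine hT 0 2 le_rfl (by norm_num) not_isOddInt_zero not_isOddInt_two ?_ ?_ ?_ ?_
    · rw [hnφ]; linarith
    · rw [hnφ]; exact hn2R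
    · linarith
    · rw [h0floor, h2floor]; norm_num
  have h := h16T d hd Φ hΦ 2 γ (by norm_num) hγ0 hW' hT' hT2
  refine h.congr fun x => ?_
  rw [hγ]
  congr 2
  ring

/-- **The recursion, iterated (`T̄^{(0,β)}`-variant)**: `Σ_x |x|^{n + 3/4} |Π(x)| < ∞` for every
integer `3 ≤ n ≤ d - 5`, from the second moment. [cite: Hara2008, §1.2.4 (proof for percolation)] -/
theorem piMoment_iterateT
    (h16T : ∀ (d : ℕ), 11 ≤ d → ∀ Φ : Site d → ℝ, IsLaceCoefficientPc d Φ →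
      ∀ β γ : ℝ, 0 ≤ β → 0 ≤ γ → haraWBar d β γ < ⊤ → haraTBar d 0 γ < ⊤ → haraTBar d 0 β < ⊤ →
        Summable fun x : Site d => euclidNorm x ^ (β + γ) * |Φ x|)
    (h17 : Hara2008_lemma17Pc) (hd : 11 ≤ d)
    {Φ : Site d → ℝ} (hΦ : IsLaceCoefficientPc d Φ)
    (hmom : Summable fun x : Site d => euclidNorm x ^ 2 * |Φ x|) :
    ∀ n : ℕ, 3 ≤ n → n ≤ d - 5 →
      Summable fun x : Site d => euclidNorm x ^ ((n : ℝ) + 3 / 4) * |Φ x| := by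
  intro n hn3 hnd
  induction n, hn3 using Nat.le_induction with
  | base =>
    have hmom' : Summable fun x : Site d => euclidNorm x ^ (2 : ℝ) * |Φ x| := by
      refine hmom.congr fun x => ?_
      rw [show (2 : ℝ) = ((2 : ℕ) : ℝ) by norm_num, Real.rpow_natCast]
    have h := piMoment_stepT h16T h17 hd hΦ (φ := 2) (n := 2) (by norm_num) le_rfl (by omega) hmom'
    refine h.congr fun x => ?_
    norm_num
  | succ n hn3 ih =>
    have ih' := ih (by omega)
    have hfloor : ⌊(n : ℝ) + 3 / 4⌋ = (n : ℤ) := by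
      rw [Int.floor_eq_iff]
      push_cast
      constructor <;> linarith
    have h := piMoment_stepT h16T h17 hd hΦ hfloor (by omega) (by omega) ih'
    refine h.congr fun x => ?_
    push_cast
    ring_nf

/-- **Output of the recursion (`T̄^{(0,β)}`-variant)**: `Ḡ^{(d-4-ε)} < ∞` with `ε = 1/4`, by
Lemma 1.7 with `φ = α = d - 4 - 1/4`. [cite: Hara2008, §1.2.4 (proof for percolation)] -/
theorem haraGBar_lt_top_of_lemma16T
    (h16T : ∀ (d : ℕ), 11 ≤ d → ∀ Φ : Site d → ℝ, IsLaceCoefficientPc d Φ →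
      ∀ β γ : ℝ, 0 ≤ β → 0 ≤ γ → haraWBar d β γ < ⊤ → haraTBar d 0 γ < ⊤ → haraTBar d 0 β < ⊤ →
        Summable fun x : Site d => euclidNorm x ^ (β + γ) * |Φ x|)
    (h17 : Hara2008_lemma17Pc) (hd : 11 ≤ d)
    {Φ : Site d → ℝ} (hΦ : IsLaceCoefficientPc d Φ)
    (hmom : Summable fun x : Site d => euclidNorm x ^ 2 * |Φ x|) :
    haraGBar d ((d : ℝ) - 17 / 4) < ⊤ := by
  have hdR : (11 : ℝ) ≤ d := by exact_mod_cast hd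
  have h := piMoment_iterateT h16T h17 hd hΦ hmom (d - 5) (by omega) le_rfl
  have hcast : (((d - 5 : ℕ) : ℝ) + 3 / 4) = (d : ℝ) - 17 / 4 := by
    rw [Nat.cast_sub (by omega)]
    push_cast
    ring
  rw [hcast] at h
  obtain ⟨hG, -, -, -, -⟩ := h17 d hd Φ hΦ ((d : ℝ) - 17 / 4) (by linarith) h
  refine hG ((d : ℝ) - 17 / 4) (by linarith) ?_ le_rfl (by linarith)
  have : (d : ℝ) - 17 / 4 = (((d : ℤ) - 4 : ℤ) : ℝ) - 1 / 4 := by push_cast; ring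
  rw [this]
  exact not_isOddInt_int_sub (by norm_num) (by norm_num)

/-! ### Steps 2–4 of the reduction from `Ḡ^{(d-4-ε)} < ∞` -/

/-- **Hara's `x`-space reduction from the output of the recursion** (§1.2.3–§1.2.4 for percolation,
`d ≥ 11`): for a lace-expansion coefficient `Φ` at `p_c` with `Ḡ^{(d-17/4)} < ∞`, Lemma 1.5 and the
Gaussian lemma (Cor. 1.4) give `|Π(x)| ≤ c⟦x⟧^{-2(d-2)}`. This is `xSpacePiBound_of_lemmas`
(`LaceExpansionXSpaceBootstrap.lean`) with its Step 1 (the recursion) abstracted into the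
hypothesis: `G ≤ β₀⟦x⟧^{-(d-4-ε)}`; Lemma 1.5 gives `|Π(x)| ≤ c₀β₀²⟦x⟧^{-2(d-4-ε)}`, whence
`|J|, |g| ≤ c⟦x⟧^{-(d+2+ρ)}` with `ρ = (d - 21/2)/2 > 0` and the moment conditions of Cor. 1.4
(`K₁ > 0` by `secondMoment_pos_of_lower'`); Cor. 1.4 with the representation `G = H` gives
`G ≤ β₁⟦x⟧^{-(d-2)}`; Lemma 1.5 again gives the claim.
[cite: Hara2008, §1.2.3 (Lemma 1.5, the two passes) and §1.2.4 (the recursion, "d > 10")] -/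
theorem xSpacePiBound_of_haraGBar (hd : 11 ≤ d) {Φ : Site d → ℝ} (hΦ : IsLaceCoefficientPc d Φ)
    (hGbar : haraGBar d ((d : ℝ) - 17 / 4) < ⊤)
    (h15 : Hara2008_lemma15Pc) (hG : Hara2008_gaussianConvolution) :
    ∃ c : ℝ, ∀ x : Site d, |Φ x| ≤ c / jnorm x ^ (2 * ((d : ℝ) - 2)) := by
  have hdR : (11 : ℝ) ≤ d := by exact_mod_cast hd
  have hd1 : 1 ≤ d := by omega
  have hd3 : 3 ≤ d := by omega
  set p : ℝ := (criticalProbI d : ℝ) with hp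
  set g := laceSource Φ with hg_def
  set J := laceKernel p Φ with hJ_def
  -- Step 1 (hypothesis): `G ≤ β₀ ⟦x⟧^{-(d - 17/4)}`
  set α₀ : ℝ := (d : ℝ) - 17 / 4 with hα₀
  obtain ⟨β₀, hβ₀, hτ₀⟩ := tau_le_of_haraGBar_lt_top hGbar
  -- Step 2: Lemma 1.5 at `α₀`
  obtain ⟨c₀, hc₀⟩ := h15 d hd Φ hΦ α₀ (by rw [hα₀]; linarith) (by rw [hα₀]; linarith)
  set s : ℝ := 2 * α₀ with hs
  have hΦ₀ : ∀ x, |Φ x| ≤ max (c₀ * β₀ ^ 2) |Φ 0| / jnorm x ^ s :=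
    decay_of_decay_ne_zero fun x hx => hc₀ β₀ hβ₀ hτ₀ x hx
  set C₀ : ℝ := max (c₀ * β₀ ^ 2) |Φ 0| with hC₀
  have hC₀nn : 0 ≤ C₀ := le_max_of_le_right (abs_nonneg _)
  have hsnn : 0 ≤ s := by rw [hs, hα₀]; linarith
  -- Step 3: decay and moments of `J`, `g`; the hypotheses of Cor. 1.4 with `ρ = (d - 21/2)/2`
  set ρ : ℝ := ((d : ℝ) - 21 / 2) / 2 with hρ
  have hρpos : 0 < ρ := by rw [hρ]; linarith
  have hgb : ∀ x, |g x| ≤ (1 + C₀) / jnorm x ^ s := abs_laceSource_le hΦ₀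
  have hJb : ∀ y, |J y| ≤ (2 * d * |p| * (2 ^ s * (1 + C₀))) / jnorm y ^ s :=
    abs_laceKernel_le hΦ₀ hsnn p
  set CJ : ℝ := 2 * d * |p| * (2 ^ s * (1 + C₀)) with hCJ
  have hCJnn : 0 ≤ CJ := by positivity
  have hsd : (d : ℝ) + 2 + ρ ≤ s := by rw [hs, hα₀, hρ]; linarith
  have hg_abs : Summable fun x => |g x| := summable_abs_of_decay hgb (by rw [hs, hα₀]; linarith)
  have hJ2 : Summable fun x => euclidNorm x ^ (2 : ℝ) * |J x| :=
    summable_rpow_mul_abs_of_decay hJb (by norm_num) (by rw [hs, hα₀]; linarith)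
  have hJ2' : Summable fun x => euclidNorm x ^ 2 * |J x| := by
    refine hJ2.congr fun x => ?_
    rw [show (2 : ℝ) = ((2 : ℕ) : ℝ) by norm_num, Real.rpow_natCast]
  have hJρ : Summable fun x => euclidNorm x ^ (2 + ρ) * |J x| :=
    summable_rpow_mul_abs_of_decay hJb (by linarith) (by rw [hs, hα₀, hρ]; linarith)
  obtain ⟨c₁, hc₁, hlow⟩ := hΦ.lower
  have hK₁ : 0 < ∑' x, euclidNorm x ^ 2 * J x :=
    secondMoment_pos_of_lower' hd1 hΦ.hasSum_one hJ2' hc₁ hlow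
  have hKer : HaraKernelHyp d J ρ :=
    { symm := isZdSymmetric_laceKernel hΦ.symm p
      rho_pos := hρpos
      hasSum_one := hΦ.hasSum_one
      lower := ⟨2 * c₁, by positivity, fun k hk => by
        have h := hlow k hk
        calc 2 * c₁ * (∑ i, k i ^ 2) / (2 * d) = c₁ * (∑ i, k i ^ 2) / d := by
              field_simp
          _ ≤ _ := h⟩
      secondMoment_pos := hK₁
      summable_sq := hJ2'
      decay := ⟨CJ, fun x => (hJb x).trans (div_jnorm_rpow_mono hCJnn (by linarith))⟩
      summable_rho := hJρ
      decay_rho := ⟨CJ, fun x => (hJb x).trans (div_jnorm_rpow_mono hCJnn hsd)⟩ }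
  have hSrc : HaraSourceHyp d g ρ :=
    { symm := isZdSymmetric_laceSource hΦ.symm
      summable := hg_abs
      decay := ⟨1 + C₀, fun x =>
        (hgb x).trans (div_jnorm_rpow_mono (by linarith) (by linarith))⟩
      decay_rho := ⟨1 + C₀, fun x =>
        (hgb x).trans (div_jnorm_rpow_mono (by linarith) (by linarith))⟩ }
  obtain ⟨-, K, R, hKR⟩ := hG d hd3 J g ρ hKer hSrc
  -- Step 4: the representation `G = H` turns the asymptotics into `G ≤ β₁ ⟦x⟧^{-(d-2)}`
  set M : ℝ := (∑' y, g y) / (∑' y, euclidNorm y ^ 2 * J y) * gaussianAmp d with hM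
  have hasym : ∀ x : Site d, R ≤ euclidNorm x →
      |tau d (criticalProbI d) 0 x - M * euclidNorm x ^ (2 - (d : ℝ))| ≤
        K * euclidNorm x ^ (-((d : ℝ) - 2 + min ρ 2 / d)) := by
    intro x hx
    have h := hKR x hx
    rw [← hΦ.repr x, ← Complex.ofReal_sub, Complex.norm_real, Real.norm_eq_abs] at h
    exact h
  obtain ⟨β₁, hβ₁, hτ₁⟩ := tau_le_jnorm_of_asymptotics (by omega) (by positivity) hasym
  -- Step 5: Lemma 1.5 at `α = d - 2`
  obtain ⟨c₂, hc₂⟩ := h15 d hd Φ hΦ ((d : ℝ) - 2) (by linarith) (by linarith)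
  refine ⟨max (c₂ * β₁ ^ 2) |Φ 0|, fun x => ?_⟩
  have h := decay_of_decay_ne_zero (fun x hx => hc₂ β₁ hβ₁ hτ₁ x hx) x
  exact h

/-- **Hara's `x`-space reduction with the `T̄^{(0,β)}`-variant of Lemma 1.6**: for a lace-expansion
coefficient `Φ` at `p_c` with finite second moment, the variant, Lemmas 1.5 and 1.7 and the Gaussian
lemma (Cor. 1.4) give `|Π(x)| ≤ c⟦x⟧^{-2(d-2)}`, `d ≥ 11`.
[cite: Hara2008, §1.2.3–§1.2.4] -/
theorem xSpacePiBound_of_lemma16T (hd : 11 ≤ d) {Φ : Site d → ℝ} (hΦ : IsLaceCoefficientPc d Φ)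
    (hmom : Summable fun x : Site d => euclidNorm x ^ 2 * |Φ x|)
    (h15 : Hara2008_lemma15Pc)
    (h16T : ∀ (d : ℕ), 11 ≤ d → ∀ Φ : Site d → ℝ, IsLaceCoefficientPc d Φ →
      ∀ β γ : ℝ, 0 ≤ β → 0 ≤ γ → haraWBar d β γ < ⊤ → haraTBar d 0 γ < ⊤ → haraTBar d 0 β < ⊤ →
        Summable fun x : Site d => euclidNorm x ^ (β + γ) * |Φ x|)
    (h17 : Hara2008_lemma17Pc) (hG : Hara2008_gaussianConvolution) :
    ∃ c : ℝ, ∀ x : Site d, |Φ x| ≤ c / jnorm x ^ (2 * ((d : ℝ) - 2)) :=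
  xSpacePiBound_of_haraGBar hd hΦ (haraGBar_lt_top_of_lemma16T h16T h17 hd hΦ hmom) h15 hG

/-! ### The assemblies with the `T̄^{(0,β)}`-variant of Lemma 1.6 -/

/-- **The `x`-space half from Prop. 1.2 at `p_c`, Lemma 1.5, the `T̄^{(0,β)}`-variant of Lemma 1.6,
Lemma 1.7 and Cor. 1.4** (`Hara2008_xSpacePiBoundPc_of_lemmas` with the variant).
[cite: Hara2008, §1.2.3–§1.2.4] -/
theorem Hara2008_xSpacePiBoundPc_of_lemma16T (h₁ : Hara2008_prop12Pc) (h15 : Hara2008_lemma15Pc)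
    (h16T : ∀ (d : ℕ), 11 ≤ d → ∀ Φ : Site d → ℝ, IsLaceCoefficientPc d Φ →
      ∀ β γ : ℝ, 0 ≤ β → 0 ≤ γ → haraWBar d β γ < ⊤ → haraTBar d 0 γ < ⊤ → haraTBar d 0 β < ⊤ →
        Summable fun x : Site d => euclidNorm x ^ (β + γ) * |Φ x|)
    (h17 : Hara2008_lemma17Pc) (hG : Hara2008_gaussianConvolution) :
    Hara2008_xSpacePiBoundPc := by
  intro d hd Φ hΦ
  obtain ⟨Ψ, hΨ, hmomΨ⟩ := h₁ d hd
  have heq : Φ = Ψ := hΦ.unique (by omega) hΨ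
  subst heq
  exact xSpacePiBound_of_lemma16T hd hΦ hmomΨ h15 h16T h17 hG

/-- **`Hara2008_laceExpansionPc` from Prop. 1.2 at `p_c`, Lemma 1.5, the `T̄^{(0,β)}`-variant of
Lemma 1.6, Lemma 1.7 and Cor. 1.4.** [cite: Hara2008, §1.2 (framework of the proof of Thm. 1.1)] -/
theorem Hara2008_laceExpansionPc_of_lemma16T (h₁ : Hara2008_prop12Pc) (h15 : Hara2008_lemma15Pc)
    (h16T : ∀ (d : ℕ), 11 ≤ d → ∀ Φ : Site d → ℝ, IsLaceCoefficientPc d Φ →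
      ∀ β γ : ℝ, 0 ≤ β → 0 ≤ γ → haraWBar d β γ < ⊤ → haraTBar d 0 γ < ⊤ → haraTBar d 0 β < ⊤ →
        Summable fun x : Site d => euclidNorm x ^ (β + γ) * |Φ x|)
    (h17 : Hara2008_lemma17Pc) (hG : Hara2008_gaussianConvolution) :
    Hara2008_laceExpansionPc :=
  Hara2008_laceExpansionPc_of_inputs h₁ (Hara2008_xSpacePiBoundPc_of_lemma16T h₁ h15 h16T h17 hG)

/-- **`η = 0` in `x`-space (`Hara2008_etaZeroXSpace`) from Prop. 1.2 at `p_c`, Lemma 1.5, the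
`T̄^{(0,β)}`-variant of Lemma 1.6, Lemma 1.7 and Cor. 1.4** (`Hara2008_etaZeroXSpace_of_lemmas`
with the variant). [cite: Hara2008, §1.2 (framework of the proof of Thm. 1.1)]
[cite: HeydenreichVanDerHofstad2017, Thm. 11.4 and pp. 137–139] -/
theorem Hara2008_etaZeroXSpace_of_lemma16T (h₁ : Hara2008_prop12Pc) (h15 : Hara2008_lemma15Pc)
    (h16T : ∀ (d : ℕ), 11 ≤ d → ∀ Φ : Site d → ℝ, IsLaceCoefficientPc d Φ →
      ∀ β γ : ℝ, 0 ≤ β → 0 ≤ γ → haraWBar d β γ < ⊤ → haraTBar d 0 γ < ⊤ → haraTBar d 0 β < ⊤ →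
        Summable fun x : Site d => euclidNorm x ^ (β + γ) * |Φ x|)
    (h17 : Hara2008_lemma17Pc) (hG : Hara2008_gaussianConvolution) :
    Hara2008_etaZeroXSpace :=
  Hara2008_etaZeroXSpace_of_laceExpansionPc (Hara2008_laceExpansionPc_of_lemma16T h₁ h15 h16T h17 hG)

/-! ### Lemma 1.5 and the final assembly from the numerical triangle bounds -/

/-- **The Hara–Slade decomposition at `p_c` for every `d ≥ 11`** from the numerical triangle bounds:
the summability hypothesis of `HvdH2017_piNDiagramBoundPc` (a theorem,
`HvdH2017_piNDiagramBoundPc_holds`) is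
`FitznerVanDerHofstad2017_triangleBoundsPc.tsum_tsum_piNDiagramPc_ne_top`
(`Σ_NΣ_x piNDiagramPc d N x < ∞` from `2Δ̃_{p_c}Δ_{p_c} < 1`, `Δ_{p_c} < ∞`).
[cite: HeydenreichVanDerHofstad2017, Prop. 6.1, (7.4.10) and Cor. 8.13 ((8.5.2) and its proof)]
[cite: FitznerVanDerHofstad2017, §7 (7.1) and proof of Thm. 1.5] -/
theorem piNDecompositionPc_of_triangleBounds (hnum : FitznerVanDerHofstad2017_triangleBoundsPc) :
    ∀ (d : ℕ), 11 ≤ d → ∀ Φ : Site d → ℝ, IsLaceCoefficientPc d Φ →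
      ∃ P : ℕ → Site d → ℝ,
        (∀ N x, 0 ≤ P N x) ∧
        (Summable fun Nx : ℕ × Site d => P Nx.1 Nx.2) ∧
        (∀ x, HasSum (fun N => (-1 : ℝ) ^ N * P N x) (Φ x)) ∧
        (∀ x, P 0 x ≤ tau d (criticalProbI d) 0 x ^ 2 - if x = 0 then 1 else 0) ∧
        (∀ N, 1 ≤ N → ∀ x, ENNReal.ofReal (P N x) ≤ piNDiagramPc d N x) :=
  fun _ hd Φ hΦ => HvdH2017_piNDiagramBoundPc_holds _ hd (hnum.tsum_tsum_piNDiagramPc_ne_top hd) Φ hΦ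

/-- **Lemma 1.5 (percolation, `d ≥ 11`) from the two-long-lines estimate and the numerical
triangle bounds** (`Hara2008_lemma15Pc_of_diagramBounds` with `piNDecompositionPc_of_triangleBounds`).
[cite: Hara2008, Lemma 1.5 and §3.5] [cite: FitznerVanDerHofstad2017, §7 (7.1)] -/
theorem Hara2008_lemma15Pc_of_triangleBounds (hL : Hara2008_twoLongLinesDiagramBoundPc)
    (hnum : FitznerVanDerHofstad2017_triangleBoundsPc) : Hara2008_lemma15Pc :=
  Hara2008_lemma15Pc_of_diagramBounds (piNDecompositionPc_of_triangleBounds hnum) hL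

/-- **`Hara2008_laceExpansionPc` from the subcritical expansion, the two-long-lines estimate and
the numerical triangle bounds**: `Hara2008_prop12Subcrit` gives Prop. 1.2 at `p_c`
(`Hara2008_prop12Pc_of_subcrit'`); Lemma 1.5 is `Hara2008_lemma15Pc_of_triangleBounds`; the
`T̄^{(0,β)}`-variant of Lemma 1.6 is `Hara2008_lemma16T_of_triangleBounds` (with
`HvdH2017_piNDiagramBoundPc_holds`); Lemma 1.7 and Cor. 1.4 are `Hara2008_lemma17Pc_holds` and
`Hara2008_gaussianConvolution_holds`.
[cite: Hara2008, §1.2, Lemmas 1.5–1.7, §3.4–§3.5 and Appendix A]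
[cite: FitznerVanDerHofstad2017, Thm. 1.4 and §7 ((7.1))] -/
theorem Hara2008_laceExpansionPc_of_numerics (hS : Hara2008_prop12Subcrit)
    (hL : Hara2008_twoLongLinesDiagramBoundPc) (hnum : FitznerVanDerHofstad2017_triangleBoundsPc) :
    Hara2008_laceExpansionPc :=
  Hara2008_laceExpansionPc_of_lemma16T (Hara2008_prop12Pc_of_subcrit' hS)
    (Hara2008_lemma15Pc_of_triangleBounds hL hnum)
    (Hara2008_lemma16T_of_triangleBounds HvdH2017_piNDiagramBoundPc_holds hnum)
    Hara2008_lemma17Pc_holds Hara2008_gaussianConvolution_holds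

/-- **`η = 0` in `x`-space for `d ≥ 11` (Heydenreich–van der Hofstad 2017, Thm. 11.4) from
`Hara2008_prop12Subcrit`, `Hara2008_twoLongLinesDiagramBoundPc` and
`FitznerVanDerHofstad2017_triangleBoundsPc`** — the complete list of unproved statements behind
`Hara2008_etaZeroXSpace` in the catalogue at this point: the subcritical lace expansion with
`p`-uniform bounds (Hara 2008, Prop. 1.2 below `p_c`), the two-long-lines estimate (§3.5), and the
computer-assisted triangle bounds `T_{p_c} ≤ 0.28036`, `T̄^{(0,0)} ≤ 0.53562` for `d ≥ 11`
(Fitzner–van der Hofstad 2017, §7, (7.1)); Hara's Gaussian lemma, the framework of §1.2 and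
Appendix A, Lemma 1.7, the bound (7.4.10) on the Hara–Slade coefficients and the weighted `N`-loop
estimate of §3.4 (in the `T̄^{(0,β)}`-variant) are theorems.
[cite: Hara2008, Thm. 1.1, §1.2 and Appendix A]
[cite: HeydenreichVanDerHofstad2017, Thm. 11.4 and pp. 137–139]
[cite: FitznerVanDerHofstad2017, Thm. 1.4 and §7 ((7.1))] -/
theorem Hara2008_etaZeroXSpace_of_numerics (hS : Hara2008_prop12Subcrit)
    (hL : Hara2008_twoLongLinesDiagramBoundPc) (hnum : FitznerVanDerHofstad2017_triangleBoundsPc) :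
    Hara2008_etaZeroXSpace :=
  Hara2008_etaZeroXSpace_of_laceExpansionPc (Hara2008_laceExpansionPc_of_numerics hS hL hnum)

end Literature.Barriers.CriticalPhenomena

end
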